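import Summits.CriticalPhenomena.PercolationContinuityZ3.Theorems.PercNearOneGluingNoHeavyLowerTailCILAveragedPortTools
import Summits.CriticalPhenomena.PercolationContinuityZ3.Theorems.PercNearOneGluingNoHeavyLowerTailCILRaiseOrder
import HarnessLib

/-!
# `NoHeavyLowerTail` (stmt-CriticalPhenomena-4575) — AVERAGED port domination for a relay-neighboured observer

Support file (prover `prim-lf-3`, lemma factory #3; `--supports stmt-CriticalPhenomena-4575`).  No definitions, no named facts,
no sorries.

Setting as in `Theorems.cil_of_portDomination`: `μ_w = prodBernoulli w` on `Fin n`, relays `A`, level `j`, an observer `o ∉ A` all of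
whose positive-weight neighbours are among the ports `p 0, …, p (d−1) ∈ A` (`p` injective); `N = |π(o)|`, lightness
`I_w(x) = μ_w{|π(x)| ≤ j}`; `F_l = {the pair o–p l is open and the pairs o–p m, m < l, are closed}` ("`p l` is the first open port").

**Theorem (`bad_le_firstOpenSum`, averaged port domination).**  If the enumeration `p` is REVERSE-GREEDY — for every `l`, the port
`p l` is at most as light as every earlier port `p m`, `m ≤ l`, in the graph `w^{(l)}` obtained from `w` by deleting the pairs `o–p i`,
`i > l` — then
  `μ_w{1 ≤ N ≤ j} ≤ Σ_l μ_w(F_l) · I_w(p l)`.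
Such an enumeration always exists (choose `p (d−1)` of minimal lightness in `w`, then `p (d−2)` of minimal lightness in `w` minus the
pair `o–p (d−1)`, and so on), and by the adjacent-exchange argument the right-hand side is at most
`E_w[max_{open ports} I_w(port); some port open]`, the value of the sum for the ports sorted by decreasing lightness.
So every relay `b` with `I_w(b) ≥ Σ_l μ_w(F_l) I_w(p l)` — in particular every `b` dominating all ports, since `Σ_l μ_w(F_l) ≤ 1`
(`Theorems.cil_of_portDomination`) — is a valid CIL witness (`cil_of_averagedPortDomination`).

Proof (crux memo LF3-APSTAR.md §3, item evidence): induction on `d`, removing the LAST port `a = p (d−1)`.  Every term is affine in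
the weight `t` of `e = s(o,a)` (`stub_oneBondDecomp_k15`) except `μ(F_{d−1})·I(a) = t·μ{earlier pairs closed}·I_t(a)`, which is
concave (`I_t(a)` is non-increasing in `t`); so the inequality at `t = w e` follows from `t = 0` (induction: the observer has the ports
`p 0..p (d−2)` and the reverse-greedy hypothesis restricts) and `t = 1` (the observer is glued to `a`: `μ{1 ≤ N ≤ j} = I(a)`, and
every earlier port is at least as light as `a` after raising the pair at `a`, `CutObserver.lightness_raise_le`; the `F_l` and
`{all earlier pairs closed}` partition the space).
-/


noncomputable section

namespace Summit.CriticalPhenomena.PercolationContinuityZ3.Theorems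

open MeasureTheory Set Literature.Probability.LatticeModels Literature.Probability.Percolation
open scoped Classical BigOperators

variable {n : ℕ}

namespace AveragedPort

/-- **Averaged port domination.**  `o ∉ A` relay-neighboured with ports `p 0..p (d−1)` (injective) in REVERSE-GREEDY order (`p l` is at
most as light as every `p m`, `m ≤ l`, once the pairs `o–p i`, `i > l`, are deleted); then
`μ{1 ≤ N ≤ j} ≤ Σ_l μ(F_l)·μ{|π(p l)| ≤ j}` with `F_l` = "`p l` is the first open port". [this file] -/
theorem bad_le_firstOpenSum :
    ∀ (d : ℕ) (w : Sym2 (Fin n) → unitInterval) (A : Finset (Fin n)) (o : Fin n) (j : ℕ) (p : Fin d → Fin n),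
      Function.Injective p → (∀ l, p l ∈ A) → o ∉ A →
      (∀ v, w s(o, v) ≠ 0 → ∃ l, v = p l) →
      (∀ l m : Fin d, m ≤ l →
        (prodBernoulli (fun e => if (∃ i : Fin d, l < i ∧ e = s(o, p i)) then (0 : unitInterval) else w e)).real
            {ω : BondConfig (Fin n) | (A.filter fun z => ω ∈ openConn (p l) z).card ≤ j} ≤
          (prodBernoulli (fun e => if (∃ i : Fin d, l < i ∧ e = s(o, p i)) then (0 : unitInterval) else w e)).real
            {ω : BondConfig (Fin n) | (A.filter fun z => ω ∈ openConn (p m) z).card ≤ j}) →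
      (prodBernoulli w).real {ω : BondConfig (Fin n) |
          1 ≤ (A.filter fun z => ω ∈ openConn o z).card ∧ (A.filter fun z => ω ∈ openConn o z).card ≤ j} ≤
        ∑ l : Fin d, (prodBernoulli w).real {ω : BondConfig (Fin n) | s(o, p l) ∈ ω ∧ ∀ m, m < l → s(o, p m) ∉ ω} *
          (prodBernoulli w).real {ω : BondConfig (Fin n) | (A.filter fun z => ω ∈ openConn (p l) z).card ≤ j} := by
  intro d
  induction d with
  | zero =>
    intro w A o j p hp hpA hoA hobs hRG
    rw [Finset.univ_eq_empty, Finset.sum_empty]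
    -- `o` is almost surely isolated: the bad event does not meet the support event
    set bad := {ω : BondConfig (Fin n) |
      1 ≤ (A.filter fun z => ω ∈ openConn o z).card ∧ (A.filter fun z => ω ∈ openConn o z).card ≤ j} with hbad
    have hempty : bad ∩ {ω : BondConfig (Fin n) | ∀ e ∈ ω, w e ≠ 0} = ∅ := by
      refine Set.eq_empty_iff_forall_notMem.2 ?_
      rintro ω ⟨⟨h1, -⟩, hωG⟩
      obtain ⟨z, hz⟩ := Finset.card_pos.1 (by omega : 0 < (A.filter fun z => ω ∈ openConn o z).card)
      rw [Finset.mem_filter] at hz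
      have hzo : z ≠ o := fun h => hoA (h ▸ hz.1)
      obtain ⟨wk⟩ := (hz.2 : (openGraph ω).Reachable o z)
      cases wk with
      | nil => exact absurd rfl hzo
      | @cons _ v _ hadj _ =>
        rw [openGraph, SimpleGraph.fromEdgeSet_adj] at hadj
        obtain ⟨l, -⟩ := hobs v (hωG _ hadj.1)
        exact l.elim0
    have := CutObserver.measureReal_inter_support w bad
    rw [hempty, measureReal_empty] at this
    rw [← this]
  | succ d ih =>
    intro w A o j p hp hpA hoA hobs hRG
    -- the last port `a`, its pair `e`, the two endpoint weight functions, the earlier ports `p'`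
    set a : Fin n := p (Fin.last d) with ha
    set e : Sym2 (Fin n) := s(o, a) with he
    set w₀ := Function.update w e 0 with hw₀
    set w₁ := Function.update w e 1 with hw₁
    set p' : Fin d → Fin n := fun i => p (Fin.castSucc i) with hp'
    have haA : a ∈ A := hpA _
    have hoa : o ≠ a := fun h => hoA (h ▸ haA)
    have hp'inj : Function.Injective p' := fun i i' h => Fin.castSucc_injective _ (hp h)
    have hp'a : ∀ i : Fin d, p' i ≠ a := fun i h => absurd (hp h) (Fin.castSucc_lt_last i).ne
    have hne_e : ∀ i : Fin d, s(o, p' i) ≠ e := fun i h => hp'a i (Sym2.congr_right.1 h)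
    have hw0e : w₀ s(o, a) = 0 := by rw [← he, hw₀, Function.update_self]
    have hw1' : w₁ = Function.update w₀ s(o, a) 1 := by rw [hw₁, hw₀, ← he, Function.update_idem]
    have hw0_agree : ∀ i : Fin d, w₀ s(o, p' i) = w s(o, p' i) := fun i => by rw [hw₀, Function.update_of_ne (hne_e i)]
    have hw1_agree : ∀ i : Fin d, w₁ s(o, p' i) = w s(o, p' i) := fun i => by rw [hw₁, Function.update_of_ne (hne_e i)]
    -- lightness sets
    set L : Fin n → Set (BondConfig (Fin n)) := fun x => {ω | (A.filter fun z => ω ∈ openConn x z).card ≤ j} with hL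
    set bad : Set (BondConfig (Fin n)) := {ω |
      1 ≤ (A.filter fun z => ω ∈ openConn o z).card ∧ (A.filter fun z => ω ∈ openConn o z).card ≤ j} with hbad
    -- (1) domination of every port by `a` in `w` itself (the reverse-greedy hypothesis at the last index)
    have hcutlast : (fun e' => if (∃ i : Fin (d+1), Fin.last d < i ∧ e' = s(o, p i)) then (0 : unitInterval) else w e') = w := by
      funext e'
      have : ¬ ∃ i : Fin (d+1), Fin.last d < i ∧ e' = s(o, p i) := fun ⟨i, hi, _⟩ => absurd hi (not_lt.2 (Fin.le_last i))
      rw [if_neg this]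
    have hdom : ∀ m : Fin (d+1), (prodBernoulli w).real (L a) ≤ (prodBernoulli w).real (L (p m)) := by
      intro m
      have h := hRG (Fin.last d) m (Fin.le_last m)
      rw [hcutlast] at h
      exact h
    -- (2) the reverse-greedy hypothesis for the earlier ports in `w₀`
    have hcut : ∀ l' : Fin d,
        (fun e' => if (∃ i : Fin d, l' < i ∧ e' = s(o, p' i)) then (0 : unitInterval) else w₀ e') =
        (fun e' => if (∃ i : Fin (d+1), Fin.castSucc l' < i ∧ e' = s(o, p i)) then (0 : unitInterval) else w e') := by
      intro l'
      funext e'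
      by_cases hC0 : ∃ i : Fin d, l' < i ∧ e' = s(o, p' i)
      · have hC1 : ∃ i : Fin (d+1), Fin.castSucc l' < i ∧ e' = s(o, p i) := by
          obtain ⟨i, hi, he'⟩ := hC0
          exact ⟨Fin.castSucc i, Fin.castSucc_lt_castSucc_iff.2 hi, he'⟩
        rw [if_pos hC0, if_pos hC1]
      · rw [if_neg hC0, hw₀, Function.update_apply]
        by_cases hee : e' = e
        · have hC1 : ∃ i : Fin (d+1), Fin.castSucc l' < i ∧ e' = s(o, p i) :=
            ⟨Fin.last d, Fin.castSucc_lt_last l', by rw [hee, he, ha]⟩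
          rw [if_pos hee, if_pos hC1]
        · have hC1 : ¬ ∃ i : Fin (d+1), Fin.castSucc l' < i ∧ e' = s(o, p i) := by
            rintro ⟨i, hi, he'⟩
            rcases Fin.eq_castSucc_or_eq_last i with ⟨i', rfl⟩ | rfl
            · exact hC0 ⟨i', Fin.castSucc_lt_castSucc_iff.1 hi, he'⟩
            · exact hee (by rw [he', he, ha])
          rw [if_neg hee, if_neg hC1]
    have hRG0 : ∀ l' m' : Fin d, m' ≤ l' →
        (prodBernoulli (fun e' => if (∃ i : Fin d, l' < i ∧ e' = s(o, p' i)) then (0 : unitInterval) else w₀ e')).real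
            (L (p' l')) ≤
          (prodBernoulli (fun e' => if (∃ i : Fin d, l' < i ∧ e' = s(o, p' i)) then (0 : unitInterval) else w₀ e')).real
            (L (p' m')) := by
      intro l' m' hml
      rw [hcut l']
      exact hRG (Fin.castSucc l') (Fin.castSucc m') (Fin.castSucc_le_castSucc_iff.2 hml)
    have hobs0 : ∀ v, w₀ s(o, v) ≠ 0 → ∃ l' : Fin d, v = p' l' := by
      intro v hv
      have hve : s(o, v) ≠ e := fun h => hv (by rw [h, hw₀, Function.update_self])
      have hv' : w s(o, v) ≠ 0 := by rwa [hw₀, Function.update_of_ne hve] at hv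
      obtain ⟨l, rfl⟩ := hobs v hv'
      rcases Fin.eq_castSucc_or_eq_last l with ⟨l', rfl⟩ | rfl
      · exact ⟨l', rfl⟩
      · exact absurd (by rw [he, ha]) hve
    -- (3) induction hypothesis at weight 0
    have hIH := ih w₀ A o j p' hp'inj (fun l => hpA _) hoA hobs0 hRG0
    -- (4) identification of the first-open events of `p'` with those of `p`
    have hFeq : ∀ l' : Fin d, {ω : BondConfig (Fin n) | s(o, p' l') ∈ ω ∧ ∀ m', m' < l' → s(o, p' m') ∉ ω} =
        {ω | s(o, p (Fin.castSucc l')) ∈ ω ∧ ∀ m, m < Fin.castSucc l' → s(o, p m) ∉ ω} := by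
      intro l'
      ext ω
      simp only [mem_setOf_eq]
      refine and_congr Iff.rfl ⟨fun h m hm => ?_, fun h m' hm' => h (Fin.castSucc m') (Fin.castSucc_lt_castSucc_iff.2 hm')⟩
      rcases Fin.eq_castSucc_or_eq_last m with ⟨m', rfl⟩ | rfl
      · exact h m' (Fin.castSucc_lt_castSucc_iff.1 hm)
      · exact absurd hm (not_lt.2 (Fin.le_last _))
    have hZeq : {ω : BondConfig (Fin n) | ∀ m, m < Fin.last d → s(o, p m) ∉ ω} = {ω | ∀ m' : Fin d, s(o, p' m') ∉ ω} := by
      ext ω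
      simp only [mem_setOf_eq]
      constructor
      · intro h m'; exact h (Fin.castSucc m') (Fin.castSucc_lt_last m')
      · intro h m hm
        rcases Fin.eq_castSucc_or_eq_last m with ⟨m', rfl⟩ | rfl
        · exact h m'
        · exact absurd hm (lt_irrefl _)
    -- (5) the measures involved
    set F : Fin (d+1) → Set (BondConfig (Fin n)) := fun l => {ω | s(o, p l) ∈ ω ∧ ∀ m, m < l → s(o, p m) ∉ ω} with hF
    set Z : Set (BondConfig (Fin n)) := {ω | ∀ m' : Fin d, s(o, p' m') ∉ ω} with hZ
    set t : ℝ := (w e : ℝ) with ht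
    have ht0 : 0 ≤ t := (w e).2.1
    have ht1 : t ≤ 1 := (w e).2.2
    have hc0 : ∀ l' : Fin d, (prodBernoulli w₀).real {ω : BondConfig (Fin n) | s(o, p' l') ∈ ω ∧ ∀ m', m' < l' → s(o, p' m') ∉ ω} =
        (prodBernoulli w).real (F (Fin.castSucc l')) := by
      intro l'
      rw [hFeq l']
      refine real_firstOpen_eq_of_agree w₀ w o p (Fin.castSucc l') (fun m hm => ?_)
      rcases Fin.eq_castSucc_or_eq_last m with ⟨m', rfl⟩ | rfl
      · exact hw0_agree m'
      · exact absurd hm (not_le.2 (Fin.castSucc_lt_last l'))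
    have hc1 : ∀ l' : Fin d, (prodBernoulli w₁).real {ω : BondConfig (Fin n) | s(o, p' l') ∈ ω ∧ ∀ m', m' < l' → s(o, p' m') ∉ ω} =
        (prodBernoulli w).real (F (Fin.castSucc l')) := by
      intro l'
      rw [hFeq l']
      refine real_firstOpen_eq_of_agree w₁ w o p (Fin.castSucc l') (fun m hm => ?_)
      rcases Fin.eq_castSucc_or_eq_last m with ⟨m', rfl⟩ | rfl
      · exact hw1_agree m'
      · exact absurd hm (not_le.2 (Fin.castSucc_lt_last l'))
    have hq1 : (prodBernoulli w₁).real Z = (prodBernoulli w).real Z := real_allClosed_eq_of_agree w₁ w o p' hw1_agree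
    have hFlast : (prodBernoulli w).real (F (Fin.last d)) = t * (prodBernoulli w).real Z := by
      have h := real_firstOpen_eq_mul w o p hp (Fin.last d)
      rw [hZeq] at h
      rw [show F (Fin.last d) = {ω | s(o, p (Fin.last d)) ∈ ω ∧ ∀ m, m < Fin.last d → s(o, p m) ∉ ω} from rfl, h, ht, he, ha]
    have hpart : ∑ l' : Fin d, (prodBernoulli w).real (F (Fin.castSucc l')) + (prodBernoulli w).real Z = 1 := by
      have h := sum_real_firstOpen_add_allClosed w₁ o p'
      rw [hq1] at h
      rw [← h]
      congr 1
      exact Finset.sum_congr rfl fun l' _ => (hc1 l').symm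
    -- (6) one-bond decompositions and the two endpoints
    have hbad_dec := stub_oneBondDecomp_k15 n w e bad
    have hIa_dec := stub_oneBondDecomp_k15 n w e (L a)
    have hI_dec : ∀ l' : Fin d, (prodBernoulli w).real (L (p' l')) =
        (1 - t) * (prodBernoulli w₀).real (L (p' l')) + t * (prodBernoulli w₁).real (L (p' l')) := fun l' => by
      rw [stub_oneBondDecomp_k15 n w e (L (p' l'))]
    have hbad1 : (prodBernoulli w₁).real bad = (prodBernoulli w₁).real (L a) := by
      rw [hw1']; exact real_bad_update_one_eq w₀ A o a j hoa haA hw0e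
    have hraise : ∀ l' : Fin d, (prodBernoulli w₁).real (L a) ≤ (prodBernoulli w₁).real (L (p' l')) := by
      intro l'
      have h := CutObserver.lightness_raise_le w A a o (p' l') j hoa.symm (hp'a l') (hdom (Fin.castSucc l'))
      rw [Sym2.eq_swap, ← he] at h
      exact h
    have hanti : (prodBernoulli w₁).real (L a) ≤ (prodBernoulli w₀).real (L a) := lightness_one_le_zero w A e a j
    -- (7) assembly
    have hIH' : (prodBernoulli w₀).real bad ≤ ∑ l' : Fin d, (prodBernoulli w).real (F (Fin.castSucc l')) *
        (prodBernoulli w₀).real (L (p' l')) := by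
      refine le_trans hIH (le_of_eq (Finset.sum_congr rfl fun l' _ => ?_))
      rw [hc0 l']
    have hstep1 : (prodBernoulli w₁).real (L a) ≤ ∑ l' : Fin d, (prodBernoulli w).real (F (Fin.castSucc l')) *
        (prodBernoulli w₁).real (L (p' l')) + (prodBernoulli w).real Z * (prodBernoulli w₁).real (L a) := by
      have h2 : ∑ l' : Fin d, (prodBernoulli w).real (F (Fin.castSucc l')) * (prodBernoulli w₁).real (L a) ≤
          ∑ l' : Fin d, (prodBernoulli w).real (F (Fin.castSucc l')) * (prodBernoulli w₁).real (L (p' l')) :=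
        Finset.sum_le_sum fun l' _ => mul_le_mul_of_nonneg_left (hraise l') measureReal_nonneg
      have h3 : ∑ l' : Fin d, (prodBernoulli w).real (F (Fin.castSucc l')) * (prodBernoulli w₁).real (L a) =
          (∑ l' : Fin d, (prodBernoulli w).real (F (Fin.castSucc l'))) * (prodBernoulli w₁).real (L a) := by
        rw [Finset.sum_mul]
      have h5 : (∑ l' : Fin d, (prodBernoulli w).real (F (Fin.castSucc l')) + (prodBernoulli w).real Z) *
          (prodBernoulli w₁).real (L a) = (prodBernoulli w₁).real (L a) := by rw [hpart, one_mul]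
      have h6 : (∑ l' : Fin d, (prodBernoulli w).real (F (Fin.castSucc l')) + (prodBernoulli w).real Z) *
          (prodBernoulli w₁).real (L a) = (∑ l' : Fin d, (prodBernoulli w).real (F (Fin.castSucc l'))) * (prodBernoulli w₁).real (L a)
          + (prodBernoulli w).real Z * (prodBernoulli w₁).real (L a) := by ring
      linarith
    have hsum_dec : ∑ l' : Fin d, (prodBernoulli w).real (F (Fin.castSucc l')) * (prodBernoulli w).real (L (p' l')) =
        (1 - t) * ∑ l' : Fin d, (prodBernoulli w).real (F (Fin.castSucc l')) * (prodBernoulli w₀).real (L (p' l')) +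
        t * ∑ l' : Fin d, (prodBernoulli w).real (F (Fin.castSucc l')) * (prodBernoulli w₁).real (L (p' l')) := by
      rw [Finset.mul_sum, Finset.mul_sum, ← Finset.sum_add_distrib]
      refine Finset.sum_congr rfl fun l' _ => ?_
      rw [hI_dec l']; ring
    -- rewrite the goal
    rw [Fin.sum_univ_castSucc]
    show (prodBernoulli w).real bad ≤ ∑ l' : Fin d, (prodBernoulli w).real (F (Fin.castSucc l')) * (prodBernoulli w).real (L (p' l')) +
        (prodBernoulli w).real (F (Fin.last d)) * (prodBernoulli w).real (L a)
    rw [hsum_dec, hFlast, hbad_dec, hIa_dec]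
    have hq0 : 0 ≤ (prodBernoulli w).real Z := measureReal_nonneg
    have hA : (1 - t) * (prodBernoulli w₀).real bad ≤
        (1 - t) * ∑ l' : Fin d, (prodBernoulli w).real (F (Fin.castSucc l')) * (prodBernoulli w₀).real (L (p' l')) :=
      mul_le_mul_of_nonneg_left hIH' (by linarith)
    have hB : t * (prodBernoulli w₁).real bad ≤ t * (∑ l' : Fin d, (prodBernoulli w).real (F (Fin.castSucc l')) *
        (prodBernoulli w₁).real (L (p' l')) + (prodBernoulli w).real Z * (prodBernoulli w₁).real (L a)) := by
      rw [hbad1]; exact mul_le_mul_of_nonneg_left hstep1 ht0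
    have hC : (prodBernoulli w₁).real (L a) ≤ (1 - t) * (prodBernoulli w₀).real (L a) + t * (prodBernoulli w₁).real (L a) := by
      have := mul_le_mul_of_nonneg_left hanti (show 0 ≤ 1 - t by linarith)
      linarith
    have hD : t * ((prodBernoulli w).real Z * (prodBernoulli w₁).real (L a)) ≤
        t * ((prodBernoulli w).real Z * ((1 - t) * (prodBernoulli w₀).real (L a) + t * (prodBernoulli w₁).real (L a))) :=
      mul_le_mul_of_nonneg_left (mul_le_mul_of_nonneg_left hC hq0) ht0
    nlinarith [hA, hB, hD]

/-- **CIL from AVERAGED port domination.**  Under the hypotheses of `bad_le_firstOpenSum` (ports in reverse-greedy order), every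
vertex `b` whose lightness is at least the first-open-port AVERAGE `Σ_l μ(F_l)·μ{|π(p l)| ≤ j}` is a valid CIL witness for `o`:
`μ{1 ≤ N ≤ j} ≤ μ{|π(b)| ≤ j}`.  (A relay dominating every port qualifies, since `Σ_l μ(F_l) ≤ 1`: `Theorems.cil_of_portDomination`.) [this file] -/
theorem cil_of_averagedPortDomination {d : ℕ} (w : Sym2 (Fin n) → unitInterval) (A : Finset (Fin n)) (o : Fin n) (j : ℕ)
    (p : Fin d → Fin n) (hp : Function.Injective p) (hpA : ∀ l, p l ∈ A) (hoA : o ∉ A)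
    (hobs : ∀ v, w s(o, v) ≠ 0 → ∃ l, v = p l)
    (hRG : ∀ l m : Fin d, m ≤ l →
      (prodBernoulli (fun e => if (∃ i : Fin d, l < i ∧ e = s(o, p i)) then (0 : unitInterval) else w e)).real
          {ω : BondConfig (Fin n) | (A.filter fun z => ω ∈ openConn (p l) z).card ≤ j} ≤
        (prodBernoulli (fun e => if (∃ i : Fin d, l < i ∧ e = s(o, p i)) then (0 : unitInterval) else w e)).real
          {ω : BondConfig (Fin n) | (A.filter fun z => ω ∈ openConn (p m) z).card ≤ j})
    (b : Fin n)
    (hb : ∑ l : Fin d, (prodBernoulli w).real {ω : BondConfig (Fin n) | s(o, p l) ∈ ω ∧ ∀ m, m < l → s(o, p m) ∉ ω} *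
          (prodBernoulli w).real {ω : BondConfig (Fin n) | (A.filter fun z => ω ∈ openConn (p l) z).card ≤ j} ≤
      (prodBernoulli w).real {ω : BondConfig (Fin n) | (A.filter fun z => ω ∈ openConn b z).card ≤ j}) :
    (prodBernoulli w).real {ω : BondConfig (Fin n) |
        1 ≤ (A.filter fun z => ω ∈ openConn o z).card ∧ (A.filter fun z => ω ∈ openConn o z).card ≤ j} ≤
      (prodBernoulli w).real {ω : BondConfig (Fin n) | (A.filter fun z => ω ∈ openConn b z).card ≤ j} :=
  (bad_le_firstOpenSum d w A o j p hp hpA hoA hobs hRG).trans hb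

end AveragedPort

end Summit.CriticalPhenomena.PercolationContinuityZ3.Theorems

end
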